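import Mathlib.Analysis.Calculus.FDeriv.Symmetric
import Literature.Analysis.FluidPDE.FlatSwirlGaugeChart
import Literature.Analysis.FluidPDE.VorticityEquation
import HarnessLib

/-!
# The transport defect of a first integral of the vorticity is pinned along the vortex lines

Analysis/FluidPDE support file, sibling of `FlatSwirlGaugeChart.lean` (kinematic vortex charts
`IsVortexChartOn`, the transport defect `transportDefect ν u α = ∂ₜα + (u·∇)α − νΔα`, drift-size
defects) and of `VorticityEquation.lean` (the vorticity equation of a classical solution). It proves
the first identity that any analysis of the FLATNESS half of route `FlatSwirlGauge`
(`NavierStokesRegularity`; crux `FlatGaugeAtSingularity`, registered stub `stub_driftSizeRegauge`)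
must start from, and which is useful for every "first integral of the vorticity" approach
(2½-D flows, the swirl `Γ = r u_θ` of axisymmetric flow, Clebsch / flux coordinates):

**Theorem** (`IsClassicalNSSolutionOn.inner_curl_gradient_transportDefect`). Let `(u, p)` be a
classical solution of the unforced Navier–Stokes system with viscosity `ν` on an open time set
`S ∋ t`, `ω = curl u`, and let `α : ℝ → ℝ³ → ℝ` be jointly `C³` at `(t, x)` with `⟪ω, ∇α⟫ = 0` near
`(t, x)` (a FIRST INTEGRAL of the vorticity: the vortex lines lie in the level sets of `α`). Then
the transport defect `f = ∂ₜα + (u·∇)α − νΔα` satisfies at `(t, x)`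

  `⟪ω, ∇f⟫ = 2ν ∑ᵢ D²α(eᵢ, ∂ᵢω) = 2ν ∇ω : ∇²α`   (any orthonormal frame `(eᵢ)`).

So `f` is NOT a free function on a vortex chart: its derivative ALONG the vortex lines is the
viscous pairing of the vortex-line shear with the Hessian of the momentum. For Euler (`ν = 0`) this
is the classical fact that the material derivative of a first integral of `ω` is again a first
integral (Kelvin–Helmholtz: vortex lines are transported); for Navier–Stokes it is the first-integral
shadow of the diffusive Clebsch-connection formulations (Constantin 2001, §2: the Weber formula
acquires a viscous commutator; Sato 2021, §4, eqs. (DO): the diffusion operator of a Clebsch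
potential is `Δα + ∇α·w^α` with `w^α` built from the Lie bracket of the conjugate pair — in that
language `f = ν ∇α·w^α`, and the present identity constrains `w^α` along `ω`).

## Contents

* Pointwise second-order calculus on a finite-dimensional inner product space (all at ONE point,
  under `ContDiffAt` hypotheses — the setting of charts defined on an open cylinder only):
  `laplacian_eq_sum_fderiv_fderiv_curried` (`Δ f x = ∑ᵢ D²f(x)(eᵢ)(eᵢ)`, unconditional),
  `laplacian_clm_apply_of_contDiffAt` (Leibniz rule `Δ⟨c, v⟩ = ⟨Δc, v⟩ + 2∑ᵢ⟨∂ᵢc, ∂ᵢv⟩ + ⟨c, Δv⟩`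
  for a covector field `c` paired with a vector field `v`), `laplacian_fderiv_apply_of_contDiffAt`
  (`Δ` commutes with `D` at a `C³` point: Schwarz twice), `hasDerivAt_fderiv_slice_of_contDiffAt`
  (mixed partials `∂ₜ D(α s)(x) = D(∂ₜα)(x)` for `uncurry α` of class `C²` at `(t, x)`).
* `fderiv_defect_apply_eq_of_firstIntegral`: the identity as PURE CALCULUS — inputs are the
  first-integral relation near `(t, x)` and the vorticity equation AT `(t, x)` (any `E`, any fields).
* Navier–Stokes wrappers on `ℝ³`: `IsClassicalNSSolutionOn.inner_curl_gradient_transportDefect`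
  (open time set), `…_cylinder` (backward cylinder `Q_ρ(T, x₀)` of a solution on `[0, T)`), and
  `IsVortexChartOn.inner_curl_gradient_transportDefect` (the route's kinematic vortex chart plus one
  more derivative on `α`; the chart itself is only `C²`, while `∇f` involves `∇Δα`).

## Proof

Write `g = Dα(ω) = ⟪ω, ∇α⟫ ≡ 0` near `(t, x)`. Then `∂ₜg = 0`, `Dg(u) = 0`, `Δg = 0` at `(t, x)`:
`D(∂ₜα)(ω) + Dα(∂ₜω) = 0`, `D²α(u, ω) + Dα(Dω u) = 0`,
`D(Δα)(ω) + 2∑ᵢ D²α(eᵢ, Dω eᵢ) + Dα(Δω) = 0` (Leibniz rule and `Δ D = D Δ`). Pair the vorticity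
equation `∂ₜω + Dω(u) = Du(ω) + νΔω` with `Dα` and expand
`Df(ω) = D(∂ₜα)(ω) + Dα(Du ω) + D²α(ω, u) − ν D(Δα)(ω)`; the four relations and the symmetry of
`D²α` leave `2ν ∑ᵢ D²α(eᵢ, Dω eᵢ)`.

## Mathlib / tree search

Mathlib (this pin): `InnerProductSpace.laplacian_eq_iteratedFDeriv_orthonormalBasis`,
`laplacian_congr_nhds`, `ContDiffAt.isSymmSndFDerivAt`, `fderiv_clm_apply`, `HasDerivAt.clm_apply`;
no Leibniz rule for the Laplacian of a pairing and no `Δ ∘ D = D ∘ Δ`. Tree: global-smoothness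
analogues `laplacian_eq_sum_fderiv_fderiv`, `curl_laplacian`, `curl_fderiv_apply`
(`VorticityCalculus`, `TaoEnstrophyLocalisationProofs`), `IsSmoothSpaceTimeOn.timeDerivWithin_fderiv_slice_apply`
(`EnergyToolkit`, one-sided within a time set); the pointwise `ContDiffAt` versions here are new.

## References

* N. Sato, *Realization of incompressible Navier–Stokes flow as superposition of transport processes
  for Clebsch potentials*, Phys. Fluids 33 (2021) 013105, §4, eqs. (DO), (DOalpha). [Sato2021]
* P. Constantin, *An Eulerian–Lagrangian approach to the Navier–Stokes equations*, Comm. Math.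
  Phys. 216 (2001) 663–686, §2. [Constantin2001]
* A. J. Majda, A. L. Bertozzi, *Vorticity and Incompressible Flow* (CUP 2002), §1.6 Prop. 1.12,
  §2.4 eq. (2.110) (vorticity equation). [MajdaBertozziCUP2002]
-/

noncomputable section

open Set Function Filter Topology InnerProductSpace
open scoped RealInnerProductSpace Laplacian

namespace Literature.Analysis.FluidPDE

/-! ### Pointwise second-order calculus -/

section PointwiseCalculus

variable {E : Type*} [NormedAddCommGroup E] [InnerProductSpace ℝ E] [FiniteDimensional ℝ E]
variable {F : Type*} [NormedAddCommGroup F] [NormedSpace ℝ F]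

/-- The Laplacian through the curried second derivative, `Δ f (x) = ∑ᵢ D²f(x)(eᵢ)(eᵢ)` over any
orthonormal basis — unconditionally (both sides are junk together). [folklore] -/
theorem laplacian_eq_sum_fderiv_fderiv_curried {ι : Type*} [Fintype ι] (b : OrthonormalBasis ι ℝ E)
    (f : E → F) (x : E) : Δ f x = ∑ i, fderiv ℝ (fderiv ℝ f) x (b i) (b i) := by
  rw [laplacian_eq_iteratedFDeriv_orthonormalBasis f b]
  simp only [iteratedFDeriv_two_apply, Matrix.cons_val_zero, Matrix.cons_val_one,
    Matrix.cons_val_fin_one]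

/-- The Laplacian of a function vanishing near `x` vanishes at `x`. [folklore] -/
theorem laplacian_eq_zero_of_eventuallyEq_zero {f : E → F} {x : E} (h : f =ᶠ[𝓝 x] 0) :
    Δ f x = 0 := by
  rw [(laplacian_congr_nhds h).eq_of_nhds]
  exact congrFun laplacian_const x

omit [InnerProductSpace ℝ E] [FiniteDimensional ℝ E] in
/-- Directional derivative of a directional derivative: for `g` with `Dg` differentiable at `x`,
`D(y ↦ Dg(y) w)(x) v = D²g(x) v w`. [folklore] -/
theorem fderiv_apply_const_apply_eq_fderiv_fderiv [NormedSpace ℝ E] {G : Type*} [NormedAddCommGroup G]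
    [NormedSpace ℝ G] {g : E → G} {x : E} (hg : DifferentiableAt ℝ (fderiv ℝ g) x) (v w : E) :
    fderiv ℝ (fun y => fderiv ℝ g y w) x v = fderiv ℝ (fderiv ℝ g) x v w := by
  rw [fderiv_clm_apply hg (differentiableAt_const w)]
  simp

/-- **Leibniz rule for the Laplacian of a duality pairing.** For `c : E → (E →L[ℝ] F)` and
`v : E → E` both `C²` at `x`,
`Δ (c·v)(x) = (Δ c)(x) (v x) + 2 ∑ᵢ (Dc(x) eᵢ) (Dv(x) eᵢ) + c(x) (Δ v (x))`. [folklore] -/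
theorem laplacian_clm_apply_of_contDiffAt {ι : Type*} [Fintype ι] (b : OrthonormalBasis ι ℝ E)
    {c : E → (E →L[ℝ] F)} {v : E → E} {x : E}
    (hc : ContDiffAt ℝ 2 c x) (hv : ContDiffAt ℝ 2 v x) :
    Δ (fun y => c y (v y)) x =
      (Δ c x) (v x) + (2 : ℝ) • ∑ i, (fderiv ℝ c x (b i)) (fderiv ℝ v x (b i)) + c x (Δ v x) := by
  -- `c`, `v` are differentiable near `x`, and `Dc`, `Dv`, `D(c·v)` are differentiable at `x`
  have hcd : ∀ᶠ y in 𝓝 x, DifferentiableAt ℝ c y :=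
    (hc.eventually (by simp)).mono fun y hy => hy.differentiableAt (by simp)
  have hvd : ∀ᶠ y in 𝓝 x, DifferentiableAt ℝ v y :=
    (hv.eventually (by simp)).mono fun y hy => hy.differentiableAt (by simp)
  have hDc : DifferentiableAt ℝ (fderiv ℝ c) x :=
    (hc.fderiv_right (m := 1) (by norm_num)).differentiableAt one_ne_zero
  have hDv : DifferentiableAt ℝ (fderiv ℝ v) x :=
    (hv.fderiv_right (m := 1) (by norm_num)).differentiableAt one_ne_zero
  have hDG : DifferentiableAt ℝ (fderiv ℝ fun y => c y (v y)) x :=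
    ((hc.clm_apply hv).fderiv_right (m := 1) (by norm_num)).differentiableAt one_ne_zero
  -- first derivative near `x`, in a fixed direction `w`
  have h1 : ∀ w, (fun y => fderiv ℝ (fun y => c y (v y)) y w) =ᶠ[𝓝 x]
      fun y => c y (fderiv ℝ v y w) + (fderiv ℝ c y w) (v y) := by
    intro w
    filter_upwards [hcd, hvd] with y hcy hvy
    rw [fderiv_clm_apply hcy hvy]
    simp
  -- second derivative at `x` in directions `w`, `w`
  have h2 : ∀ w, fderiv ℝ (fderiv ℝ fun y => c y (v y)) x w w =
      fderiv ℝ (fderiv ℝ c) x w w (v x) + (2 : ℝ) • (fderiv ℝ c x w) (fderiv ℝ v x w) +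
        c x (fderiv ℝ (fderiv ℝ v) x w w) := by
    intro w
    have hcw : DifferentiableAt ℝ (fun y => fderiv ℝ c y w) x := hDc.clm_apply (differentiableAt_const w)
    have hvw : DifferentiableAt ℝ (fun y => fderiv ℝ v y w) x := hDv.clm_apply (differentiableAt_const w)
    rw [← fderiv_apply_const_apply_eq_fderiv_fderiv hDG, (h1 w).fderiv_eq,
      fderiv_fun_add (hcd.self_of_nhds.clm_apply hvw) (hcw.clm_apply hvd.self_of_nhds),
      fderiv_clm_apply hcd.self_of_nhds hvw, fderiv_clm_apply hcw hvd.self_of_nhds]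
    simp only [FunLike.coe_add, Pi.add_apply, ContinuousLinearMap.comp_apply,
      ContinuousLinearMap.flip_apply, fderiv_apply_const_apply_eq_fderiv_fderiv hDv,
      fderiv_apply_const_apply_eq_fderiv_fderiv hDc, two_smul]
    abel
  rw [laplacian_eq_sum_fderiv_fderiv_curried b, laplacian_eq_sum_fderiv_fderiv_curried b c,
    laplacian_eq_sum_fderiv_fderiv_curried b v]
  simp only [h2, Finset.sum_add_distrib, FunLike.coe_sum, Finset.sum_apply, map_sum, Finset.smul_sum]

/-- **The Laplacian commutes with the derivative** at a point where the function is `C³`: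
`(Δ (Df))(x) w = D(Δ f)(x) w` (Schwarz's theorem twice). [folklore] -/
theorem laplacian_fderiv_apply_of_contDiffAt {ι : Type*} [Fintype ι] (b : OrthonormalBasis ι ℝ E)
    {f : E → F} {x : E} (hf : ContDiffAt ℝ 3 f x) (w : E) :
    (Δ (fderiv ℝ f) x) w = fderiv ℝ (Δ f) x w := by
  -- regularity
  have hDf : ContDiffAt ℝ 2 (fderiv ℝ f) x := hf.fderiv_right (m := 2) (by norm_num)
  have hD2f : DifferentiableAt ℝ (fderiv ℝ (fderiv ℝ f)) x :=
    (hDf.fderiv_right (m := 1) (by norm_num)).differentiableAt one_ne_zero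
  -- symmetry of `D²f` near `x` and of `D²(Df)` at `x`
  have hsym2 : ∀ᶠ y in 𝓝 x, IsSymmSndFDerivAt ℝ f y :=
    (hf.eventually (by simp)).mono fun y hy =>
      hy.isSymmSndFDerivAt (by simp only [minSmoothness_of_isRCLikeNormedField]; norm_num)
  have hsym3 : IsSymmSndFDerivAt ℝ (fderiv ℝ f) x := hDf.isSymmSndFDerivAt (by simp)
  -- `D³f(x)(v₁)(v₂)(v₃)` is symmetric in `(v₂, v₃)`: differentiate the symmetry of `D²f` near `x`
  have hsym23 : ∀ v₁ v₂ v₃, fderiv ℝ (fderiv ℝ (fderiv ℝ f)) x v₁ v₂ v₃ =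
      fderiv ℝ (fderiv ℝ (fderiv ℝ f)) x v₁ v₃ v₂ := by
    intro v₁ v₂ v₃
    have hev : (fun y => fderiv ℝ (fderiv ℝ f) y v₂ v₃) =ᶠ[𝓝 x]
        fun y => fderiv ℝ (fderiv ℝ f) y v₃ v₂ := hsym2.mono fun y hy => hy v₂ v₃
    have key : fderiv ℝ (fun y => fderiv ℝ (fderiv ℝ f) y v₂ v₃) x v₁ =
        fderiv ℝ (fun y => fderiv ℝ (fderiv ℝ f) y v₃ v₂) x v₁ :=
      DFunLike.congr_fun (hev.fderiv_eq (𝕜 := ℝ)) v₁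
    have hd₂ : DifferentiableAt ℝ (fun y => fderiv ℝ (fderiv ℝ f) y v₂) x :=
      hD2f.clm_apply (differentiableAt_const _)
    have hd₃ : DifferentiableAt ℝ (fun y => fderiv ℝ (fderiv ℝ f) y v₃) x :=
      hD2f.clm_apply (differentiableAt_const _)
    rw [show (fun y => fderiv ℝ (fderiv ℝ f) y v₂ v₃) = fun y => (fun y => fderiv ℝ (fderiv ℝ f) y v₂) y v₃
        from rfl, fderiv_clm_apply hd₂ (differentiableAt_const _)] at key
    rw [show (fun y => fderiv ℝ (fderiv ℝ f) y v₃ v₂) = fun y => (fun y => fderiv ℝ (fderiv ℝ f) y v₃) y v₂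
        from rfl, fderiv_clm_apply hd₃ (differentiableAt_const _)] at key
    simpa [fderiv_apply_const_apply_eq_fderiv_fderiv hD2f] using key
  -- left-hand side: `∑ᵢ D³f(x)(eᵢ)(eᵢ)(w)`
  rw [laplacian_eq_sum_fderiv_fderiv_curried b (fderiv ℝ f), FunLike.coe_sum, Finset.sum_apply]
  -- right-hand side: `D(y ↦ ∑ᵢ D²f(y)(eᵢ)(eᵢ))(x) w = ∑ᵢ D³f(x)(w)(eᵢ)(eᵢ)`
  have hΔ : Δ f = fun y => ∑ i, fderiv ℝ (fderiv ℝ f) y (b i) (b i) :=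
    funext fun y => laplacian_eq_sum_fderiv_fderiv_curried b f y
  have hdi : ∀ i, DifferentiableAt ℝ (fun y => fderiv ℝ (fderiv ℝ f) y (b i) (b i)) x := fun i =>
    (hD2f.clm_apply (differentiableAt_const _)).clm_apply (differentiableAt_const _)
  rw [hΔ, fderiv_fun_sum fun i _ => hdi i, FunLike.coe_sum, Finset.sum_apply]
  refine Finset.sum_congr rfl fun i _ => ?_
  have hstep : fderiv ℝ (fun y => fderiv ℝ (fderiv ℝ f) y (b i) (b i)) x w =
      fderiv ℝ (fderiv ℝ (fderiv ℝ f)) x w (b i) (b i) := by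
    rw [show (fun y => fderiv ℝ (fderiv ℝ f) y (b i) (b i)) =
        fun y => (fun y => fderiv ℝ (fderiv ℝ f) y (b i)) y (b i) from rfl,
      fderiv_clm_apply (hD2f.clm_apply (differentiableAt_const _)) (differentiableAt_const _)]
    simp [fderiv_apply_const_apply_eq_fderiv_fderiv hD2f]
  rw [hstep, hsym23 (b i) (b i) w, hsym3 (b i) w]

/-- The Laplacian of a function of class `C³` at `x` is differentiable at `x`. [folklore] -/
theorem differentiableAt_laplacian_of_contDiffAt {f : E → F} {x : E} (hf : ContDiffAt ℝ 3 f x) :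
    DifferentiableAt ℝ (Δ f) x := by
  have hD2f : DifferentiableAt ℝ (fderiv ℝ (fderiv ℝ f)) x :=
    ((hf.fderiv_right (m := 2) (by norm_num)).fderiv_right (m := 1) (by norm_num)).differentiableAt
      one_ne_zero
  have hΔ : Δ f = fun y => ∑ i, fderiv ℝ (fderiv ℝ f) y (stdOrthonormalBasis ℝ E i)
      (stdOrthonormalBasis ℝ E i) :=
    funext fun y => laplacian_eq_sum_fderiv_fderiv_curried _ f y
  rw [hΔ]
  exact DifferentiableAt.fun_sum fun i _ =>
    (hD2f.clm_apply (differentiableAt_const _)).clm_apply (differentiableAt_const _)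

end PointwiseCalculus

/-! ### Mixed partials of a jointly `C²` field at a point -/

section MixedPartials

variable {E : Type*} [NormedAddCommGroup E] [NormedSpace ℝ E]
variable {F : Type*} [NormedAddCommGroup F] [NormedSpace ℝ F]

/-- **Mixed partials commute, pointwise form.** For `α : ℝ → E → F` with `uncurry α` of class `C²`
at `(t, x)`: the time derivative `y ↦ ∂ₜα(t, y)` of the slices is differentiable at `x`, and the
operator-valued map `s ↦ D(α s)(x)` has derivative `D(∂ₜα(t, ·))(x)` at `t` (both are the second
derivative of `uncurry α` at `(t, x)` on the pairs `((1,0),(0,w))`, `((0,w),(1,0))`, which agree by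
the symmetry of second derivatives). [folklore] -/
theorem hasDerivAt_fderiv_slice_of_contDiffAt {α : ℝ → E → F} {t : ℝ} {x : E}
    (hα : ContDiffAt ℝ 2 (uncurry α) (t, x)) :
    DifferentiableAt ℝ (fun y => deriv (fun s => α s y) t) x ∧
      HasDerivAt (fun s => fderiv ℝ (α s) x)
        (fderiv ℝ (fun y => deriv (fun s => α s y) t) x) t := by
  set W : ℝ × E → F := uncurry α with hWdef
  set A : ℝ × E → (ℝ × E →L[ℝ] F) := fderiv ℝ W with hAdef
  have hWd : ∀ᶠ z in 𝓝 (t, x), DifferentiableAt ℝ W z :=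
    (hα.eventually (by simp)).mono fun z hz => hz.differentiableAt (by simp)
  have hA : DifferentiableAt ℝ A (t, x) :=
    (hα.fderiv_right (m := 1) (by norm_num)).differentiableAt one_ne_zero
  have hsym : IsSymmSndFDerivAt ℝ W (t, x) :=
    hα.isSymmSndFDerivAt (by simp only [minSmoothness_of_isRCLikeNormedField]; exact le_rfl)
  -- slices of the derivative of `W`
  have hslice : ∀ᶠ z in 𝓝 (t, x),
      HasFDerivAt (α z.1) ((A z).comp (ContinuousLinearMap.inr ℝ ℝ E)) z.2 ∧
        HasDerivAt (fun s => α s z.2) (A z (1, 0)) z.1 := by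
    filter_upwards [hWd] with ⟨s, y⟩ hz
    refine ⟨hz.hasFDerivAt.comp y (hasFDerivAt_prodMk_right s y), ?_⟩
    have h := (hz.hasFDerivAt.comp s (hasFDerivAt_prodMk_left s y)).hasDerivAt
    simp only [ContinuousLinearMap.comp_apply, ContinuousLinearMap.inl_apply] at h
    exact h
  -- (1) along the time line through `x`: `D(α s)(x) = A(s, x) ∘ inr` for `s` near `t`
  have hline_t : Tendsto (fun s : ℝ => (s, x)) (𝓝 t) (𝓝 (t, x)) :=
    (continuous_id.prodMk continuous_const).tendsto t
  have hc_ev : (fun s => fderiv ℝ (α s) x) =ᶠ[𝓝 t]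
      fun s => (A (s, x)).comp (ContinuousLinearMap.inr ℝ ℝ E) := by
    filter_upwards [hline_t.eventually hslice] with s hs
    exact hs.1.fderiv
  have hc₂ : HasDerivAt (fun s => (A (s, x)).comp (ContinuousLinearMap.inr ℝ ℝ E))
      ((fderiv ℝ A (t, x) (1, 0)).comp (ContinuousLinearMap.inr ℝ ℝ E)) t := by
    have h1 : HasDerivAt (fun s : ℝ => A (s, x)) (fderiv ℝ A (t, x) (1, 0)) t := by
      have h := (hA.hasFDerivAt.comp t (hasFDerivAt_prodMk_left t x)).hasDerivAt
      simp only [ContinuousLinearMap.comp_apply, ContinuousLinearMap.inl_apply] at h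
      exact h
    exact ((ContinuousLinearMap.compL ℝ E (ℝ × E) F).flip
      (ContinuousLinearMap.inr ℝ ℝ E)).hasFDerivAt.comp_hasDerivAt t h1
  -- (2) along the space slice through `t`: `∂ₜα(t, y) = A(t, y)(1, 0)` for `y` near `x`
  have hline_x : Tendsto (fun y : E => (t, y)) (𝓝 x) (𝓝 (t, x)) :=
    (continuous_const.prodMk continuous_id).tendsto x
  have ha_ev : (fun y => deriv (fun s => α s y) t) =ᶠ[𝓝 x] fun y => A (t, y) (1, 0) := by
    filter_upwards [hline_x.eventually hslice] with y hy
    exact hy.2.deriv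
  have ha₂ : HasFDerivAt (fun y => A (t, y) (1, 0))
      ((A (t, x)).comp (0 : E →L[ℝ] ℝ × E) +
        ((fderiv ℝ A (t, x)).comp (ContinuousLinearMap.inr ℝ ℝ E)).flip (1, 0)) x :=
    (hA.hasFDerivAt.comp x (hasFDerivAt_prodMk_right t x)).clm_apply
      (hasFDerivAt_const ((1 : ℝ), (0 : E)) x)
  -- the two candidate derivatives agree by symmetry
  have hLeq : (A (t, x)).comp (0 : E →L[ℝ] ℝ × E) +
      ((fderiv ℝ A (t, x)).comp (ContinuousLinearMap.inr ℝ ℝ E)).flip (1, 0) =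
        (fderiv ℝ A (t, x) (1, 0)).comp (ContinuousLinearMap.inr ℝ ℝ E) := by
    ext w
    simp only [FunLike.coe_add, Pi.add_apply, ContinuousLinearMap.comp_apply,
      FunLike.coe_zero, Pi.zero_apply, map_zero, zero_add, ContinuousLinearMap.flip_apply,
      ContinuousLinearMap.inr_apply]
    exact hsym _ _
  have ha : HasFDerivAt (fun y => deriv (fun s => α s y) t)
      ((fderiv ℝ A (t, x) (1, 0)).comp (ContinuousLinearMap.inr ℝ ℝ E)) x :=
    (hLeq ▸ ha₂).congr_of_eventuallyEq ha_ev
  refine ⟨ha.differentiableAt, ?_⟩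
  rw [ha.fderiv]
  exact hc₂.congr_of_eventuallyEq hc_ev

end MixedPartials

/-! ### The identity (pure calculus form) -/

section Identity

variable {E : Type*} [NormedAddCommGroup E] [InnerProductSpace ℝ E] [FiniteDimensional ℝ E]

/-- **The transport defect of a first integral, differentiated along the field** (pure-calculus
core of Sato's identity (DO)). Let `α : ℝ → E → ℝ` be jointly `C³` at `(t, x)`, `ω : ℝ → E → E`
jointly `C²` at `(t, x)`, `u t` differentiable at `x`; suppose `α` is a FIRST INTEGRAL of `ω` near
`(t, x)` (`D(α s)(y) (ω s y) = 0`, i.e. `⟪ω, ∇α⟫ = 0`) and that the VORTICITY EQUATION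
`∂ₜω + (u·∇)ω = (ω·∇)u + νΔω` holds at `(t, x)`. Then the transport defect
`f = ∂ₜα + (u·∇)α − νΔα` satisfies, at `(t, x)`,
`Df (ω) = 2ν ∑ᵢ D²α(eᵢ, Dω eᵢ) = 2ν ∇ω : ∇²α`.
Proof: differentiate `Dα(ω) = 0` in `t`, along `u`, and twice in space (Leibniz rule for the
Laplacian), insert the vorticity equation paired with `Dα`, and use the symmetry of `D²α`, `D³α`. [folklore] -/
theorem fderiv_defect_apply_eq_of_firstIntegral {ι : Type*} [Fintype ι]
    (b : OrthonormalBasis ι ℝ E) {ν : ℝ} {u ω : ℝ → E → E} {α : ℝ → E → ℝ} {t : ℝ} {x : E}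
    (hα : ContDiffAt ℝ 3 (uncurry α) (t, x)) (hω : ContDiffAt ℝ 2 (uncurry ω) (t, x))
    (hu : DifferentiableAt ℝ (u t) x)
    (hfi : ∀ᶠ z in 𝓝 (t, x), fderiv ℝ (α z.1) z.2 (ω z.1 z.2) = 0)
    (hvort : deriv (fun s => ω s x) t + fderiv ℝ (ω t) x (u t x) =
      fderiv ℝ (u t) x (ω t x) + ν • Δ (ω t) x) :
    fderiv ℝ (fun y => deriv (fun s => α s y) t + fderiv ℝ (α t) y (u t y) - ν * Δ (α t) y) x
        (ω t x) =
      2 * ν * ∑ i, fderiv ℝ (fderiv ℝ (α t)) x (b i) (fderiv ℝ (ω t) x (b i)) := by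
  -- ## regularity of the slices
  have ha3 : ContDiffAt ℝ 3 (α t) x :=
    hα.comp x (contDiffAt_const.prodMk contDiffAt_id)
  have hw2 : ContDiffAt ℝ 2 (ω t) x :=
    hω.comp x (contDiffAt_const.prodMk contDiffAt_id)
  have hDa : ContDiffAt ℝ 2 (fderiv ℝ (α t)) x := ha3.fderiv_right (m := 2) (by norm_num)
  have hDad : DifferentiableAt ℝ (fderiv ℝ (α t)) x := hDa.differentiableAt (by simp)
  have hdw : DifferentiableAt ℝ (ω t) x := hw2.differentiableAt (by simp)
  have hsymA : IsSymmSndFDerivAt ℝ (α t) x :=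
    ha3.isSymmSndFDerivAt (by simp only [minSmoothness_of_isRCLikeNormedField]; norm_num)
  have hΔa : DifferentiableAt ℝ (Δ (α t)) x := differentiableAt_laplacian_of_contDiffAt ha3
  -- mixed partials of `α`, time derivative of `ω`
  obtain ⟨hadot, hc⟩ := hasDerivAt_fderiv_slice_of_contDiffAt (hα.of_le (by norm_num))
  have hωdot : HasDerivAt (fun s => ω s x) (deriv (fun s => ω s x) t) t := by
    have hd : DifferentiableAt ℝ (uncurry ω ∘ fun s : ℝ => (s, x)) t :=
      (hω.differentiableAt (by simp)).comp t (differentiableAt_id.prodMk (differentiableAt_const x))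
    exact hd.hasDerivAt
  -- the first-integral identity along the time line and along the space slice
  have hline_t : Tendsto (fun s : ℝ => (s, x)) (𝓝 t) (𝓝 (t, x)) :=
    (continuous_id.prodMk continuous_const).tendsto t
  have hline_x : Tendsto (fun y : E => (t, y)) (𝓝 x) (𝓝 (t, x)) :=
    (continuous_const.prodMk continuous_id).tendsto x
  have hg_t : (fun s => fderiv ℝ (α s) x (ω s x)) =ᶠ[𝓝 t] fun _ => (0 : ℝ) :=
    hline_t.eventually hfi
  have hg_x : (fun y => fderiv ℝ (α t) y (ω t y)) =ᶠ[𝓝 x] fun _ => (0 : ℝ) :=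
    hline_x.eventually hfi
  -- ## (⋆t) differentiate `Dα(ω) = 0` in time
  have key_t : fderiv ℝ (fun y => deriv (fun s => α s y) t) x (ω t x) +
      fderiv ℝ (α t) x (deriv (fun s => ω s x) t) = 0 := by
    have h1 : HasDerivAt (fun s => fderiv ℝ (α s) x (ω s x))
        (fderiv ℝ (fun y => deriv (fun s => α s y) t) x (ω t x) +
          fderiv ℝ (α t) x (deriv (fun s => ω s x) t)) t := hc.clm_apply hωdot
    have h0 : HasDerivAt (fun s => fderiv ℝ (α s) x (ω s x)) 0 t :=
      (hasDerivAt_const t (0 : ℝ)).congr_of_eventuallyEq hg_t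
    exact h1.unique h0
  -- ## (⋆x) differentiate `Dα(ω) = 0` along `u`
  have key_x : fderiv ℝ (α t) x (fderiv ℝ (ω t) x (u t x)) +
      fderiv ℝ (fderiv ℝ (α t)) x (u t x) (ω t x) = 0 := by
    have h := DFunLike.congr_fun (hg_x.fderiv_eq (𝕜 := ℝ)) (u t x)
    rw [fderiv_clm_apply hDad hdw] at h
    simpa using h
  -- ## (⋆Δ) the Laplacian of `Dα(ω) = 0`
  have key_Δ : fderiv ℝ (Δ (α t)) x (ω t x) +
      2 * ∑ i, fderiv ℝ (fderiv ℝ (α t)) x (b i) (fderiv ℝ (ω t) x (b i)) +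
        fderiv ℝ (α t) x (Δ (ω t) x) = 0 := by
    have h := laplacian_clm_apply_of_contDiffAt b hDa hw2
    rw [laplacian_eq_zero_of_eventuallyEq_zero hg_x, laplacian_fderiv_apply_of_contDiffAt b ha3] at h
    rw [smul_eq_mul] at h
    linarith
  -- ## (⋆v) the vorticity equation paired with `Dα`
  have key_v : fderiv ℝ (α t) x (deriv (fun s => ω s x) t) +
      fderiv ℝ (α t) x (fderiv ℝ (ω t) x (u t x)) =
        fderiv ℝ (α t) x (fderiv ℝ (u t) x (ω t x)) + ν * fderiv ℝ (α t) x (Δ (ω t) x) := by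
    have h := congrArg (fderiv ℝ (α t) x) hvort
    simpa [map_add, map_smul] using h
  -- ## expand the left-hand side
  have hconv : DifferentiableAt ℝ (fun y => fderiv ℝ (α t) y (u t y)) x := hDad.clm_apply hu
  have hvisc : DifferentiableAt ℝ (fun y => ν * Δ (α t) y) x := hΔa.const_mul ν
  have hL : fderiv ℝ (fun y => deriv (fun s => α s y) t + fderiv ℝ (α t) y (u t y) - ν * Δ (α t) y) x
      (ω t x) =
      fderiv ℝ (fun y => deriv (fun s => α s y) t) x (ω t x) +
        (fderiv ℝ (α t) x (fderiv ℝ (u t) x (ω t x)) +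
          fderiv ℝ (fderiv ℝ (α t)) x (ω t x) (u t x)) -
        ν * fderiv ℝ (Δ (α t)) x (ω t x) := by
    rw [fderiv_fun_sub (hadot.fun_add hconv) hvisc, fderiv_fun_add hadot hconv,
      fderiv_clm_apply hDad hu, fderiv_const_mul hΔa]
    simp
  rw [hL, hsymA (ω t x) (u t x)]
  linear_combination key_t + key_x - key_v - ν * key_Δ

end Identity

/-! ### Navier–Stokes: the identity for first integrals of the vorticity -/

section NavierStokes

variable {ν : ℝ} {u : ℝ → EuclideanSpace ℝ (Fin 3) → EuclideanSpace ℝ (Fin 3)}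
  {p : ℝ → EuclideanSpace ℝ (Fin 3) → ℝ} {α : ℝ → EuclideanSpace ℝ (Fin 3) → ℝ}

/-- Inner product with a gradient is the derivative: `⟪v, ∇φ(x)⟫ = Dφ(x) v` (real case of Mathlib's
`inner_gradient_right`). [folklore] -/
private theorem real_inner_gradient_right_fin3 (φ : EuclideanSpace ℝ (Fin 3) → ℝ)
    (x v : EuclideanSpace ℝ (Fin 3)) : ⟪v, gradient φ x⟫ = fderiv ℝ φ x v := by
  rw [real_inner_comm, inner_gradient_left]

/-- The vorticity of a classical solution on an OPEN time set is jointly smooth, hence jointly `Cⁿ`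
at every point of `S × ℝ³`. [folklore] -/
theorem IsClassicalNSSolutionOn.contDiffAt_uncurry_vorticity {S : Set ℝ}
    {f : ℝ → EuclideanSpace ℝ (Fin 3) → EuclideanSpace ℝ (Fin 3)}
    (hcl : IsClassicalNSSolutionOn S ν f u p) (hS : IsOpen S) {n : ℕ∞} {t : ℝ} (ht : t ∈ S)
    (x : EuclideanSpace ℝ (Fin 3)) :
    ContDiffAt ℝ (n : WithTop ℕ∞) (uncurry (vorticity u)) (t, x) := by
  have hv : vorticity u = fun s y => curlCLM (fderiv ℝ (u s) y) := by funext s y; rfl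
  have hsm : IsSmoothSpaceTimeOn S (vorticity u) := by
    rw [hv]; exact (hcl.smooth_velocity.fderiv_slice hS.uniqueDiffOn).clm_comp curlCLM
  have hopen : IsOpen (S ×ˢ (univ : Set (EuclideanSpace ℝ (Fin 3)))) := hS.prod isOpen_univ
  exact ((hsm (t, x) (mk_mem_prod ht (mem_univ x))).contDiffAt (hopen.mem_nhds
    (mk_mem_prod ht (mem_univ x)))).of_le (by exact_mod_cast le_top)

/-- **The transport defect of a first integral of the vorticity is pinned along the vortex lines.**
Let `(u, p)` be a classical solution of the unforced Navier–Stokes system with viscosity `ν` on an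
OPEN time set `S`, `t ∈ S`, and let the momentum `α : ℝ → ℝ³ → ℝ` be jointly `C³` at `(t, x)` and a
FIRST INTEGRAL OF THE VORTICITY near `(t, x)` (`⟪curl u, ∇α⟫ = 0`, i.e. `α` is one Clebsch / flux
coordinate of `ω = curl u`). Then its transport defect `f = ∂ₜα + (u·∇)α − νΔα`
(`Literature.Analysis.FluidPDE.transportDefect`) obeys at `(t, x)`
`⟪curl u, ∇f⟫ = 2ν ∑ᵢ D²α(eᵢ, ∂ᵢ(curl u)) = 2ν ∇ω : ∇²α` (any orthonormal frame `eᵢ`): the defect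
is NOT a free function — its derivative along the vortex lines is the viscous pairing of the
vortex-line shear with the Hessian of the momentum. For the Euler equations (`ν = 0`) this is the
classical statement that `Dα/Dt` is again a first integral; for Navier–Stokes it is the
first-integral shadow of the diffusive Clebsch-connection formulations (Constantin 2001, §2: the
Weber formula acquires a viscous commutator; Sato 2021, §4, eqs. (DO): the diffusion operator on a
Clebsch potential is `Δα + ∇α·w^α`, i.e. `f = ν ∇α·w^α`, with `w^α` built from the Lie bracket of
the conjugate pair). Proof: `fderiv_defect_apply_eq_of_firstIntegral` with the vorticity equation
`IsClassicalNSSolutionOn.vorticity_eq` at the interior time `t`. [folklore] -/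
theorem IsClassicalNSSolutionOn.inner_curl_gradient_transportDefect {ι : Type*} [Fintype ι]
    (b : OrthonormalBasis ι ℝ (EuclideanSpace ℝ (Fin 3))) {S : Set ℝ}
    (hcl : IsClassicalNSSolutionOn S ν 0 u p) (hS : IsOpen S) {t : ℝ}
    {x : EuclideanSpace ℝ (Fin 3)} (ht : t ∈ S) (hα : ContDiffAt ℝ 3 (uncurry α) (t, x))
    (hfi : ∀ᶠ z in 𝓝 (t, x), ⟪curl (u z.1) z.2, gradient (α z.1) z.2⟫ = 0) :
    ⟪curl (u t) x, gradient (transportDefect ν u α t) x⟫ =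
      2 * ν * ∑ i, fderiv ℝ (fderiv ℝ (α t)) x (b i) (fderiv ℝ (curl (u t)) x (b i)) := by
  -- the vorticity equation at the interior time `t`, two-sided time derivative
  have hV := hcl.isVorticitySolutionOn_of_isOpen hS fun _ _ y => curl_zero y
  have hvort := hV.vorticity_eq t ht x
  rw [timeDerivWithin_of_mem_interior (by rwa [hS.interior_eq]), timeDeriv_apply] at hvort
  simp only [vorticity_apply, convect_apply] at hvort
  -- hypotheses of the pure-calculus core
  have hω : ContDiffAt ℝ 2 (uncurry (vorticity u)) (t, x) :=
    hcl.contDiffAt_uncurry_vorticity (n := 2) hS ht x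
  have hu : DifferentiableAt ℝ (u t) x :=
    ((hcl.contDiff_velocity ht).differentiable (by simp)).differentiableAt
  have hfi' : ∀ᶠ z in 𝓝 (t, x), fderiv ℝ (α z.1) z.2 (vorticity u z.1 z.2) = 0 := by
    filter_upwards [hfi] with z hz
    rw [real_inner_gradient_right_fin3] at hz
    simpa only [vorticity_apply] using hz
  have key := fderiv_defect_apply_eq_of_firstIntegral b hα hω hu hfi'
    (by simpa only [vorticity_apply] using hvort)
  have hdef : transportDefect ν u α t =
      fun y => deriv (fun s => α s y) t + fderiv ℝ (α t) y (u t y) - ν * Δ (α t) y := by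
    funext y; rfl
  rw [real_inner_gradient_right_fin3, hdef]
  simpa only [vorticity_apply] using key

/-- **The identity on a backward cylinder** (the setting of route `FlatSwirlGauge` of
`NavierStokesRegularity`): for a classical unforced solution on `[0, T)` and a momentum `α` of
class `C³` on `Q_ρ(T, x₀) = (T − ρ², T) × B_ρ(x₀)` (`ρ² < T`) that is a first integral of the
vorticity on `Q_ρ`, the transport defect satisfies `⟪curl u, ∇f⟫ = 2ν ∇(curl u) : ∇²α` at every
point of `Q_ρ`. (The kinematic vortex chart `Literature.Analysis.FluidPDE.IsVortexChartOn` supplies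
the first-integral clause with `α ∈ C²` only; the identity needs one more derivative.) [folklore] -/
theorem IsClassicalNSSolutionOn.inner_curl_gradient_transportDefect_cylinder {ι : Type*}
    [Fintype ι] (b : OrthonormalBasis ι ℝ (EuclideanSpace ℝ (Fin 3))) {T ρ : ℝ}
    {x₀ : EuclideanSpace ℝ (Fin 3)} (hcl : IsClassicalNSSolutionOn (Ico 0 T) ν 0 u p)
    (hρT : ρ ^ 2 < T) (hα : ContDiffOn ℝ 3 (uncurry α) (Ioo (T - ρ ^ 2) T ×ˢ Metric.ball x₀ ρ))
    (hfi : ∀ t ∈ Ioo (T - ρ ^ 2) T, ∀ x ∈ Metric.ball x₀ ρ,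
      ⟪curl (u t) x, gradient (α t) x⟫ = 0)
    {t : ℝ} (ht : t ∈ Ioo (T - ρ ^ 2) T) {x : EuclideanSpace ℝ (Fin 3)}
    (hx : x ∈ Metric.ball x₀ ρ) :
    ⟪curl (u t) x, gradient (transportDefect ν u α t) x⟫ =
      2 * ν * ∑ i, fderiv ℝ (fderiv ℝ (α t)) x (b i) (fderiv ℝ (curl (u t)) x (b i)) := by
  have hsub : Ioo (T - ρ ^ 2) T ⊆ Ico 0 T := fun s hs =>
    ⟨by nlinarith [hs.1, sq_nonneg ρ], hs.2⟩
  have hcl' : IsClassicalNSSolutionOn (Ioo (T - ρ ^ 2) T) ν 0 u p :=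
    hcl.mono hsub (uniqueDiffOn_Ioo _ _)
  have hQ : IsOpen (Ioo (T - ρ ^ 2) T ×ˢ Metric.ball x₀ ρ) := isOpen_Ioo.prod Metric.isOpen_ball
  have hmem : (t, x) ∈ Ioo (T - ρ ^ 2) T ×ˢ Metric.ball x₀ ρ := mk_mem_prod ht hx
  refine hcl'.inner_curl_gradient_transportDefect b isOpen_Ioo ht
    ((hα (t, x) hmem).contDiffAt (hQ.mem_nhds hmem)) ?_
  filter_upwards [hQ.mem_nhds hmem] with z hz
  exact hfi z.1 hz.1 z.2 hz.2

/-- **The identity in a kinematic vortex chart.** In the setting of the registered cut of the crux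
`FlatGaugeAtSingularity` of route `FlatSwirlGauge` (`IsVortexChartOn u T x₀ ρ C₀ M α d`, whose clause
`⟪curl u, ∇α⟫ = 0` makes `α` a first integral of the vorticity on `Q_ρ(T, x₀)`), with the momentum
additionally of class `C³` on the cylinder, the transport defect of `α` is pinned along the vortex
lines: `⟪curl u, ∇(transportDefect ν u α t)⟫ = 2ν ∇(curl u) : ∇²α` on `Q_ρ(T, x₀)`. This is the
input any proof or refutation of the drift-size re-gauging (`HasDriftSizeDefectOn`) starts from: a
re-gauge `α' = Φ(t, α)` changes `f` by the leafwise-constant data `Φ_t + Φ_a f − ν Φ_aa ‖∇α‖²`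
(`transportDefect_add_time` and its kin in `FlatSwirlGaugeRelabel.lean`), while the variation of
`f` ALONG each vortex line is fixed by the right-hand side. [folklore] -/
theorem IsVortexChartOn.inner_curl_gradient_transportDefect {ι : Type*} [Fintype ι]
    (b : OrthonormalBasis ι ℝ (EuclideanSpace ℝ (Fin 3))) {T ρ C₀ M : ℝ}
    {x₀ : EuclideanSpace ℝ (Fin 3)} {d : ℝ → EuclideanSpace ℝ (Fin 3) → ℝ}
    (hch : IsVortexChartOn u T x₀ ρ C₀ M α d) (hcl : IsClassicalNSSolutionOn (Ico 0 T) ν 0 u p)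
    (hα : ContDiffOn ℝ 3 (uncurry α) (Ioo (T - ρ ^ 2) T ×ˢ Metric.ball x₀ ρ))
    {t : ℝ} (ht : t ∈ Ioo (T - ρ ^ 2) T) {x : EuclideanSpace ℝ (Fin 3)}
    (hx : x ∈ Metric.ball x₀ ρ) :
    ⟪curl (u t) x, gradient (transportDefect ν u α t) x⟫ =
      2 * ν * ∑ i, fderiv ℝ (fderiv ℝ (α t)) x (b i) (fderiv ℝ (curl (u t)) x (b i)) :=
  hcl.inner_curl_gradient_transportDefect_cylinder b hch.2.1 hα
    (fun s hs y hy => (hch.2.2.2.2 s hs y hy).2.1) ht hx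

end NavierStokes

end Literature.Analysis.FluidPDE

end
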